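import Literature.Topology.FourManifolds.NonSeparatingSpheresCover
import Mathlib.Analysis.Convex.Contractible
import HarnessLib

/-!
# Budney–Gabai Thm. 3.13: lifting a loop of `S¹ × Sⁿ` to the cyclic cover, and its degree

Companion to `Literature/Topology/FourManifolds/NonSeparatingSpheresCover.lean` (the cyclic
cover `(t, p) ↦ (e^{it}, p) : ℝ × Sⁿ → S¹ × Sⁿ` of the fact seat of
`Literature.Topology.FourManifolds.BudneyGabai2019_thm_3_13`; R. Budney, D. Gabai, *Knotted
3-balls in `S⁴`*, arXiv:1912.09029, Thm. 3.13).  In the proof of Thm. 3.13 (p. 22) the dual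
circle `c : S¹ → S¹ × Sⁿ` of a non-separating sphere is isotoped onto `S¹ × {*}`; the homotopy
class of `c` is its **degree over `S¹`**, the integer `d` by which a lift of `c` to the cover is
translated after one turn.  This file constructs the lift and the degree:

* `BudneyGabai2019_thm_3_13.exists_loopLift` — for a continuous `c : S¹ → S¹ × Sⁿ` there are a
  continuous `c̃ : ℝ → ℝ × Sⁿ` and `d ∈ ℤ` with `(exp × id) (c̃ θ) = c (cos θ, sin θ)` and
  `c̃ (θ + 2π) = (c̃ θ)₁ + 2πd, (c̃ θ)₂)` for all `θ` (the first coordinate lifts through the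
  covering `exp : ℝ → S¹` over the simply connected line, `CircleExpLift`; `θ ↦ c̃₁ (θ + 2π)`
  and `θ ↦ c̃₁ θ + 2πd` are two lifts of the same map agreeing at `0`, hence equal — Hatcher,
  *Algebraic Topology*, Prop. 1.34);
* `BudneyGabai2019_thm_3_13.exists_loopLift_smooth` — if `c` is `C^∞` so is `c̃`
  (`CircleExpLift.contMDiff_of_continuous`);
* `BudneyGabai2019_thm_3_13.loopLift_add_int_mul` — iterating: `c̃ (θ + 2πk) = τ_{kd} (c̃ θ)` for
  `k ∈ ℤ`, `τ_m (t, p) = (t + 2πm, p)` the deck transformations.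

Everything here is proved; no definition and no named fact is introduced.  The circle is
parametrised by the tree's `circlePoint θ = (cos θ, sin θ)` (`Knots.lean`).

## References

* R. Budney, D. Gabai, *Knotted 3-balls in `S⁴`*, arXiv:1912.09029 (v2), §3, proof of Thm. 3.13
  (p. 22). [BudneyGabai2019]
* A. Hatcher, *Algebraic Topology*, CUP (2002), §1.1 (degree of a circle map via lifts),
  Props. 1.30, 1.33, 1.34. [HatcherAT2002]
-/

noncomputable section

open scoped Manifold ContDiff Topology Real
open Set Function Metric

namespace Literature.Topology.FourManifolds

namespace BudneyGabai2019_thm_3_13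

variable {n : ℕ}

/-- **Lift of a loop of `S¹ × Sⁿ` to the cyclic cover, with its degree.**  For a continuous
`c : S¹ → S¹ × Sⁿ` there are a continuous `c̃ : ℝ → ℝ × Sⁿ` and an integer `d` such that
`(exp × id) ∘ c̃ = c ∘ circlePoint` and `c̃ (θ + 2π) = ((c̃ θ)₁ + 2πd, (c̃ θ)₂)` for every `θ`
(Hatcher, *Algebraic Topology*, §1.1 and Prop. 1.34: the first coordinate lifts through
`exp : ℝ → S¹` over the simply connected line, and the two lifts `θ ↦ c̃₁(θ + 2π)`,
`θ ↦ c̃₁ θ + 2πd` of the same circle map agree at `0`, hence everywhere).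
[cite: HatcherAT2002, §1.1 and Prop. 1.34] -/
theorem exists_loopLift
    (c : C(Metric.sphere (0 : EuclideanSpace ℝ (Fin 2)) 1,
      Circle × Metric.sphere (0 : EuclideanSpace ℝ (Fin (n + 1))) 1)) :
    ∃ ct : ℝ → ℝ × Metric.sphere (0 : EuclideanSpace ℝ (Fin (n + 1))) 1, Continuous ct ∧
      ∃ d : ℤ, (∀ θ, (Prod.map Circle.exp id (ct θ) :
          Circle × Metric.sphere (0 : EuclideanSpace ℝ (Fin (n + 1))) 1) = c (circlePoint θ)) ∧
        ∀ θ, ct (θ + 2 * π) = ((ct θ).1 + d * (2 * π), (ct θ).2) := by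
  -- the line is simply connected and locally path connected
  haveI : ContractibleSpace ℝ :=
    (Homeomorph.Set.univ ℝ).contractibleSpace_iff.1
      ((convex_univ : Convex ℝ (univ : Set ℝ)).contractibleSpace univ_nonempty)
  -- lift the first coordinate
  set f : C(ℝ, Circle) := ⟨fun θ ↦ (c (circlePoint θ)).1,
    continuous_fst.comp (c.continuous.comp continuous_circlePoint)⟩ with hf
  obtain ⟨g, hg⟩ := CircleExpLift.exists_continuousMap_comp_eq f
  set ct : ℝ → ℝ × Metric.sphere (0 : EuclideanSpace ℝ (Fin (n + 1))) 1 :=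
    fun θ ↦ (g θ, (c (circlePoint θ)).2) with hct
  have hctc : Continuous ct :=
    g.continuous.prodMk (continuous_snd.comp (c.continuous.comp continuous_circlePoint))
  -- the degree: `g (2π) = g 0 + 2π d`
  have hper : ∀ θ, Circle.exp (g (θ + 2 * π)) = Circle.exp (g θ) := fun θ ↦ by
    rw [hg, hg]
    change (c (circlePoint (θ + 2 * π))).1 = (c (circlePoint θ)).1
    rw [circlePoint_add_two_pi]
  obtain ⟨d, hd⟩ := Circle.exp_eq_exp.1 (hper 0)
  -- two lifts of the same map agreeing at `0`
  have heq : (fun θ ↦ g (θ + 2 * π)) = fun θ ↦ g θ + d * (2 * π) := by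
    refine Circle.isCoveringMap_exp.eq_of_comp_eq (g.continuous.comp (continuous_id.add continuous_const))
      (g.continuous.add continuous_const) (funext fun θ ↦ ?_) 0 (by simpa using hd)
    simp only [comp_apply]
    rw [hper θ, Circle.exp_eq_exp]
    exact ⟨-d, by push_cast; ring⟩
  refine ⟨ct, hctc, d, fun θ ↦ ?_, fun θ ↦ ?_⟩
  · simp only [hct, Prod.map_apply, id_eq, hg]
    rfl
  · simp only [hct, Prod.mk.injEq]
    exact ⟨congr_fun heq θ, by rw [circlePoint_add_two_pi]⟩

/-- **The lift of a smooth loop is smooth** (its first coordinate is a continuous lift through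
`exp` of a smooth circle-valued map, `CircleExpLift.contMDiff_of_continuous`; the second is the
second coordinate of `c ∘ circlePoint`). [folklore] -/
theorem exists_loopLift_smooth
    {c : Metric.sphere (0 : EuclideanSpace ℝ (Fin 2)) 1 →
      Circle × Metric.sphere (0 : EuclideanSpace ℝ (Fin (n + 1))) 1}
    (hc : ContMDiff (𝓡 1) ((𝓡 1).prod (𝓡 n)) ∞ c) :
    ∃ ct : ℝ → ℝ × Metric.sphere (0 : EuclideanSpace ℝ (Fin (n + 1))) 1,
      ContMDiff 𝓘(ℝ, ℝ) (𝓘(ℝ, ℝ).prod (𝓡 n)) ∞ ct ∧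
      ∃ d : ℤ, (∀ θ, (Prod.map Circle.exp id (ct θ) :
          Circle × Metric.sphere (0 : EuclideanSpace ℝ (Fin (n + 1))) 1) = c (circlePoint θ)) ∧
        ∀ θ, ct (θ + 2 * π) = ((ct θ).1 + d * (2 * π), (ct θ).2) := by
  obtain ⟨ct, hctc, d, hlift', hdeck⟩ := exists_loopLift ⟨c, hc.continuous⟩
  have hlift : ∀ θ, (Prod.map Circle.exp id (ct θ) :
      Circle × Metric.sphere (0 : EuclideanSpace ℝ (Fin (n + 1))) 1) = c (circlePoint θ) := hlift'
  refine ⟨ct, ?_, d, hlift, hdeck⟩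
  have hcθ : ContMDiff 𝓘(ℝ, ℝ) ((𝓡 1).prod (𝓡 n)) ∞ (fun θ ↦ c (circlePoint θ)) :=
    hc.comp contMDiff_circlePoint
  have h1 : ContMDiff 𝓘(ℝ, ℝ) 𝓘(ℝ, ℝ) ∞ (fun θ ↦ (ct θ).1) := by
    refine CircleExpLift.contMDiff_of_continuous (continuous_fst.comp hctc) ?_
    have : (fun θ ↦ Circle.exp ((ct θ).1)) = fun θ ↦ (c (circlePoint θ)).1 :=
      funext fun θ ↦ by rw [← hlift θ]; rfl
    rw [this]
    exact contMDiff_fst.comp hcθ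
  have h2 : ContMDiff 𝓘(ℝ, ℝ) (𝓡 n) ∞ (fun θ ↦ (ct θ).2) := by
    have : (fun θ ↦ (ct θ).2) = fun θ ↦ (c (circlePoint θ)).2 :=
      funext fun θ ↦ by rw [← hlift θ]; rfl
    rw [this]
    exact contMDiff_snd.comp hcθ
  exact h1.prodMk h2

/-- **Iterated deck translation of a lifted loop**: if `c̃ (θ + 2π) = τ_d (c̃ θ)` for all `θ`,
then `c̃ (θ + 2πk) = τ_{kd} (c̃ θ)` for every integer `k`, where `τ_m (t, p) = (t + 2πm, p)`.
[folklore] -/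
theorem loopLift_add_int_mul {ct : ℝ → ℝ × Metric.sphere (0 : EuclideanSpace ℝ (Fin (n + 1))) 1}
    {d : ℤ} (hdeck : ∀ θ, ct (θ + 2 * π) = ((ct θ).1 + d * (2 * π), (ct θ).2)) (k : ℤ) (θ : ℝ) :
    ct (θ + k * (2 * π)) = ((ct θ).1 + (k * d : ℤ) * (2 * π), (ct θ).2) := by
  induction k using Int.induction_on generalizing θ with
  | zero => simp
  | succ k ih =>
    have e : θ + ((k : ℤ) + 1 : ℤ) * (2 * π) = θ + ((k : ℤ) : ℝ) * (2 * π) + 2 * π := by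
      push_cast; ring
    rw [e, hdeck, ih]
    ext
    · push_cast
      ring
    · rfl
  | pred k ih =>
    have e : θ + (-(k : ℤ) - 1 : ℤ) * (2 * π) = θ - 2 * π + (-(k : ℤ) : ℤ) * (2 * π) := by
      push_cast; ring
    have h' : ct (θ - 2 * π) = ((ct θ).1 - d * (2 * π), (ct θ).2) := by
      have := hdeck (θ - 2 * π)
      rw [sub_add_cancel] at this
      rw [this]
      ext
      · simp
      · rfl
    rw [e, ih, h']
    ext
    · push_cast
      ring
    · rfl

end BudneyGabai2019_thm_3_13

end Literature.Topology.FourManifolds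

end
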